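/-
Copyright (c) 2026 the pub-hodgecm-mathlib formalisation cell (harness21).  Prover seat hodgecm-mathlib-K2E3-p28 (g3) (E3 hand lent to strike line L1 by CHAIR K2-lead (g2)
VALVE WORD W4; LEAD F0P6-plan (g14) BATCH #108 (3) «U1 STAGE-3 B2b», desk K2E3-p14 (g9) 22:54:44Z (2) + 23:04:15Z «=»), Track B «K2-LIT» ∕ hLiu418 =
stmt-HodgeConjecture-24832: organ U1-CT-ind stage 3 («U1-glob»), brick B2b FILE 2 — ★ G1's Euler head with ONE place `v₀ ∈ T` isolated (the `htail` letter of
★ `K2LiuSingularWhittakerPlaceFactor` §2 at the adelic carriers).  THEOREMS ONLY.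
-/
import Summits.HodgeConjecture.HodgeConjecture.Theorems.K2LiuSingularWhittakerPlaceFactor    -- ★ B2b FILE 1 (this seat): `integral_prod_pi_eq_mul_of_pureAt` (integrability-free isolation)
import Summits.HodgeConjecture.HodgeConjecture.Theorems.K2LiuWhittakerDeltaEulerProduct        -- ★ G1 (K2Liu-p12): `whittakerDelta_eq_mul_tprod_euler`
import HarnessLib

/-!
# Crux `HLiu418`, organ U1-CT-ind STAGE 3 («U1-glob»), brick B2b FILE 2: ★ G1's EULER HEAD WITH THE PLACE `v₀ ∈ T` ISOLATED —
# `W_S(f_s)(h) = W_{S,v₀}(bT_s)(h_{v₀}) · (HEAD_{T∖v₀} · ∏'_{v∉T} W°_{S,v}(s))` for a head family pure at `v₀`   [KudlaRallis1994 §2; Tan1999 §3]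

Cell `hodgecm-mathlib`, crux item hLiu418 = `stmt-HodgeConjecture-24832`; squad K2, strike line L1, LEAD F0P6-plan (g14) (BATCH #108 (3)); desk K2E3-p14 (g9) + K2E5-p16 (g8);
second hand (local half) LH7-p06 (g2); prover K2E3-p28 (g3).  Lane `--supports stmt-HodgeConjecture-24832 --as helper` (count-neutral).  THEOREMS ONLY (no `def`, no
`instance`, no notation, no named-fact hypothesis, no `sorry`).

THE POINT (desk K2E3-p14 (g9) 22:54:44Z (2)).  B2b = «EULER-FACTORISE `whittakerDelta νN₀ S (f s) h` for `f` PURE AT `v₀` on the convergence half-plane, isolate the `v₀`-factor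
`Fn s hv`, put everything else into `G`, and EXTEND the identity by the identity theorem».  ★ FILE 1 `K2LiuSingularWhittakerPlaceFactor` is the generic isolation engine (§1,
integrability-free) and the transport (§2); THIS file is the isolation AT THE CARRIERS: ★ G1 `K2LiuWhittakerDeltaEulerProduct.whittakerDelta_eq_mul_tprod_euler` writes
`W_S(f_s)(h) = HEAD_T · ∏'_{v∉T} W°_{S,v}(s)` with ONE head integral over `ν_∞ ⊗ ⨂_{v∈T} ν_v` — the place `v₀ ∈ T` (bad in general: it is where U1-glob's kernel vector lives,
non-split) is not split off.  For a head family PURE AT `v₀` as a function, `fT s (a, q) = bT s (q v₀) · rT s (a, q|_{w ≠ v₀})` (e.g. `f = stdExtension 𝒦 ½ (a ⊗ b)`,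
★ BRICK 3 `K2LiuStdExtensionPlaceFactorisation`), ★ FILE 1 §1 `integral_prod_pi_eq_mul_of_pureAt` splits the head (no integrability hypothesis beyond ★ G1's own `hG`):
* §1 **`whittakerDelta_eq_localFactor_mul_of_pureAt`** — ★ G1's letters VERBATIM + `(v₀ : ↥T) (bT) (rT) (hpure)` ⊢
  `W_S(f_s)(h) = [∫_{N_Δ(L⁺_{v₀})} conj ψ_S(ι_{v₀} y) · bT_s(w_{Δ,v₀}·y·h_{v₀}) dν_{v₀}(y)] · ([∫ (conj ψ_S(p_∞)·∏_{w≠v₀} conj ψ_S(ι_w p_w)) · rT_s(w_Δ p_∞ h_∞, (w_{Δ,w}·p_w·h_w)_{w≠v₀})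
   d(ν_∞ ⊗ ⨂_{w≠v₀} ν_w)] · ∏'_{v∉T} W°_{S,v}(s))`
  — the LOC factor is LH7-p06 (g2)'s local reading `Gn s h_{v₀}` (★ (K1a-3) `K2LiuRankOneSingularLocalRegularity.twistedRankOneRegularity_of_forall_eq` conj. 2, regular on
  `{0 < re}`), the bracket is the `Rst` letter of ★ FILE 1 §2 (its `(s − ½)`-clearing `G` = ★ (K1a-4) `exists_Eac_of_tail_letters` called with `W := Rst`, by name).
Heartbeats: ONE `maxHeartbeats 800000` on the head = ★ G1's own MEASURED class (> 400 000 measured here too: the adelic doubled unitary datum + the Haar∕Borel tower);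
the proof is `rw [★ G1, ★ FILE 1 §1]` + `exact mul_assoc _ _ _` (a `rw [mul_assoc]` on this goal exceeds 800 000 in `isDefEq` — measured, avoided).
References: [KudlaRallis1994] S. Kudla, S. Rallis, Ann. of Math. 140 (1994), §2; [Tan1999] V. Tan, Canad. J. Math. 51 (1999), §3 (`W_β = ⊗_v W_{β,v}`);
[Folland1995] G. Folland, *A Course in Abstract Harmonic Analysis* (1995), §2.2.
HONEST LABEL.  Count-neutral helper: `HC_CM` is proved only modulo the 7 printed citations (2 remaining named inputs: hLiu418 = `stmt-HodgeConjecture-24832`,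
h413 = `stmt-HodgeConjecture-24833`) until rung 0 closes; U1-glob itself stays OPEN (B2a′, B2b-local, B4, B5).
-/

set_option autoImplicit false
set_option linter.dupNamespace false -- the mandated namespace repeats `HodgeConjecture.HodgeConjecture`

noncomputable section

open scoped BigOperators Topology
open MeasureTheory MeasureTheory.Measure Set Filter
open Summit.HodgeConjecture.HodgeConjecture.Cruxes.HLiu418.K2LiuSingularWhittakerPlaceFactor (integral_prod_pi_eq_mul_of_pureAt)

namespace Summit.HodgeConjecture.HodgeConjecture.Cruxes.HLiu418.K2LiuSingularWhittakerPlaceFactorEuler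

/-! ## §1 ★ G1's Euler head RE-BRACKETED for a head family pure at `v₀ ∈ T` -/

section Euler

open scoped Matrix RestrictedProduct ENNReal NNReal ComplexConjugate
open NumberField IsDedekindDomain
open Literature.NumberTheory.Automorphic Literature.NumberTheory.GaloisRepresentations
open Literature.NumberTheory.GelbartRogawski1991 Literature.NumberTheory.GelbartRogawski1991.GRConstruction
open Literature.NumberTheory.K2Lit.SiegelDoubled
open Literature.NumberTheory.K2Lit.PlaceSplitting
open Literature.MeasureTheory.RestrictedProduct
open Literature.Topology.Algebra.RestrictedProduct (inH)
open Summit.HodgeConjecture.HodgeConjecture.Cruxes.HLiu418.K2LiuSiegelUnipotentLocalDefs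
open Summit.HodgeConjecture.HodgeConjecture.Cruxes.HLiu418.K2LiuSiegelUnipotentSplitDefs
open Summit.HodgeConjecture.HodgeConjecture.Cruxes.HLiu418.K2LiuSiegelUnipotentSplitAtDefs
open Summit.HodgeConjecture.HodgeConjecture.Cruxes.HLiu418.K2LiuSiegelUnipotentFourierDefs
open Summit.HodgeConjecture.HodgeConjecture.Cruxes.HLiu418.K2LiuWhittakerDeltaEulerProduct (whittakerDelta_eq_mul_tprod_euler)

variable (L : Type) [Field L] [NumberField L] [IsCMField L]
variable {N M n : ℕ} (e : Fin N × Fin M ≃ Fin n)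
  (dV : Fin N → L) (hdV : ∀ i, IsCMField.complexConj L (dV i) = dV i)
  (dW : Fin M → L) (hdW : ∀ i, IsCMField.complexConj L (dW i) = dW i)
  (T : Finset (HeightOneSpectrum (𝓞 (Fp L)))) [DecidableEq (HeightOneSpectrum (𝓞 (Fp L)))]
  [MeasurableSpace ↥(unipDelta L e dV hdV dW hdW)] [BorelSpace ↥(unipDelta L e dV hdV dW hdW)]
  [MeasurableSpace ↥(unipDeltaArch L e dV hdV dW hdW)] [BorelSpace ↥(unipDeltaArch L e dV hdV dW hdW)]
  [∀ v : HeightOneSpectrum (𝓞 (Fp L)), MeasurableSpace ↥(unipDeltaLoc L e dV hdV dW hdW v)] [∀ v : HeightOneSpectrum (𝓞 (Fp L)), BorelSpace ↥(unipDeltaLoc L e dV hdV dW hdW v)]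

set_option maxHeartbeats 800000 in -- MEASURED (> 400 000, ≤ 800 000): ★ G1's statement class — the adelic doubled unitary datum + the Haar∕Borel tower; `rw` ×2 + `exact mul_assoc`
/-- **★ G1's EULER HEAD WITH THE PLACE `v₀ ∈ T` ISOLATED (the `htail` letter of ★ `K2LiuSingularWhittakerPlaceFactor` §2 at the carriers).**  ★ `whittakerDelta_eq_mul_tprod_euler`'s letters verbatim, plus: the
head family `fT` is PURE AT `v₀ ∈ T` as a function — `fT s (a, q) = bT s (q v₀) · rT s (a, q|_{w ≠ v₀})` (`hpure`; e.g. `f = stdExtension 𝒦 ½ (a ⊗ b)` with `b` a local section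
at `v₀`, ★ BRICK 3 `K2LiuStdExtensionPlaceFactorisation`).  THEN on the convergence half-plane (wherever ★ G1 holds):
`W_S(f_s)(h) = [∫_{N_Δ(L⁺_{v₀})} conj ψ_S(ι_{v₀} y) · bT_s(w_{Δ,v₀}·y·h_{v₀}) dν_{v₀}(y)] · ([∫ (conj ψ_S(p_∞)·∏_{w∈T, w≠v₀} conj ψ_S(ι_w p_w)) · rT_s(w_Δ p_∞ h_∞, (w_{Δ,w} p_w h_w)_{w≠v₀}) d(ν_∞ ⊗ ⨂_{w≠v₀} ν_w)] · ∏'_{v∉T} W°_{S,v}(s))`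
— ★ G1 then ★ FILE 1 `integral_prod_pi_eq_mul_of_pureAt` on the head (no integrability hypothesis beyond ★ G1's own `hG`) then `mul_assoc`. [cite: KudlaRallis1994, §2] [cite: Tan1999, §3]
[cite: Folland1995, §2.2] -/
theorem whittakerDelta_eq_localFactor_mul_of_pureAt
    (νN : Measure ↥(unipDelta L e dV hdV dW hdW)) (νv : ∀ v : HeightOneSpectrum (𝓞 (Fp L)), Measure ↥(unipDeltaLoc L e dV hdV dW hdW v)) [∀ v, (νv v).IsHaarMeasure]
    [∀ v, SigmaFinite (νv v)]
    (hνK : ∀ v, v ∉ T → νv v (((inH (fun v => UnitaryGroup.localInt L (IsCMField.complexConj L) (n + n) (hermD L e dV hdV dW hdW) v) (fun v => unipDeltaLoc L e dV hdV dW hdW v) v) : Subgroup ↥(unipDeltaLoc L e dV hdV dW hdW v)) : Set ↥(unipDeltaLoc L e dV hdV dW hdW v)) = 1)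
    (νinf : Measure ↥(unipDeltaArch L e dV hdV dW hdW)) [SigmaFinite νinf]
    (hmap : Measure.map (unipDeltaSplitAt L e dV hdV dW hdW T) νN =
      νinf.prod ((Measure.pi fun v : T => νv v.1).prod
        (rpMeasure (fun v : {v : HeightOneSpectrum (𝓞 (Fp L)) // v ∉ T} => ((inH (fun v => UnitaryGroup.localInt L (IsCMField.complexConj L) (n + n) (hermD L e dV hdV dW hdW) v) (fun v => unipDeltaLoc L e dV hdV dW hdW v) v.1 : Subgroup ↥(unipDeltaLoc L e dV hdV dW hdW v.1)) : Set ↥(unipDeltaLoc L e dV hdV dW hdW v.1))) (fun v => νv v.1) ∅)))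
    {χ : HeckeCharacter L} (hχ : ∀ v, v ∉ T → ∀ w' : UnitaryGroup.PlacesOver L v, χ.IsUnramifiedAt w'.1)
    {f : ℂ → HA L e dV hdV dW hdW → ℂ}
    {fT : ℂ → UnitaryGroup.arch (Fp L) L (IsCMField.complexConj L) (n + n) (hermD L e dV hdV dW hdW) ×
      (Π v : T, UnitaryGroup.localPi L (IsCMField.complexConj L) (n + n) (hermD L e dV hdV dW hdW) v.1) → ℂ}
    (hfac : IsFactorizableOff L e dV hdV dW hdW T χ f fT)
    -- purity of the head family at `v₀ ∈ T`
    (v₀ : T) (bT : ℂ → UnitaryGroup.localPi L (IsCMField.complexConj L) (n + n) (hermD L e dV hdV dW hdW) v₀.1 → ℂ)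
    (rT : ℂ → UnitaryGroup.arch (Fp L) L (IsCMField.complexConj L) (n + n) (hermD L e dV hdV dW hdW) ×
      (Π w : {w : T // w ≠ v₀}, UnitaryGroup.localPi L (IsCMField.complexConj L) (n + n) (hermD L e dV hdV dW hdW) w.1.1) → ℂ)
    (hpure : ∀ (s : ℂ) (a : UnitaryGroup.arch (Fp L) L (IsCMField.complexConj L) (n + n) (hermD L e dV hdV dW hdW))
      (q : Π v : T, UnitaryGroup.localPi L (IsCMField.complexConj L) (n + n) (hermD L e dV hdV dW hdW) v.1),
      fT s (a, q) = bT s (q v₀) * rT s (a, fun w : {w : T // w ≠ v₀} => q w.1))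
    (s : ℂ) (S : Matrix (Fin n) (Fin n) L) {h : HA L e dV hdV dW hdW}
    (hh : ∀ v, v ∉ T → UnitaryGroup.evalPlace (Fp L) L (IsCMField.complexConj L) (n + n) (hermD L e dV hdV dW hdW) v
      (UnitaryGroup.finPart (Fp L) L (IsCMField.complexConj L) (n + n) (hermD L e dV hdV dW hdW) h) ∈
        UnitaryGroup.localInt L (IsCMField.complexConj L) (n + n) (hermD L e dV hdV dW hdW) v)
    (hw : ∀ v, v ∉ T → UnitaryGroup.evalPlace (Fp L) L (IsCMField.complexConj L) (n + n) (hermD L e dV hdV dW hdW) v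
      (UnitaryGroup.finPart (Fp L) L (IsCMField.complexConj L) (n + n) (hermD L e dV hdV dW hdW) (weylDelta L e dV hdV dW hdW)) ∈
        UnitaryGroup.localInt L (IsCMField.complexConj L) (n + n) (hermD L e dV hdV dW hdW) v)
    (hS : ∀ v, v ∉ T → ∀ (w : UnitaryGroup.PlacesOver L v) (i j : Fin n), ((S i j : L) : w.1.adicCompletion L) ∈ w.1.adicCompletionIntegers L)
    (hG : Integrable (fun u : ↥(unipDelta L e dV hdV dW hdW) =>
      conj (unipDeltaChar L e dV hdV dW hdW S (u : HA L e dV hdV dW hdW) : ℂ) * f s (weylDelta L e dV hdV dW hdW * (u : HA L e dV hdV dW hdW) * h)) νN) :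
    whittakerDelta L e dV hdV dW hdW νN S (f s) h =
      (∫ y, conj (unipDeltaChar L e dV hdV dW hdW S
            (locToAdelic L e dV hdV dW hdW v₀.1 (y : UnitaryGroup.localPi L (IsCMField.complexConj L) (n + n) (hermD L e dV hdV dW hdW) v₀.1)) : ℂ) *
          bT s (UnitaryGroup.evalPlace (Fp L) L (IsCMField.complexConj L) (n + n) (hermD L e dV hdV dW hdW) v₀.1
                (UnitaryGroup.finPart (Fp L) L (IsCMField.complexConj L) (n + n) (hermD L e dV hdV dW hdW) (weylDelta L e dV hdV dW hdW)) *
              (y : UnitaryGroup.localPi L (IsCMField.complexConj L) (n + n) (hermD L e dV hdV dW hdW) v₀.1) *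
              UnitaryGroup.evalPlace (Fp L) L (IsCMField.complexConj L) (n + n) (hermD L e dV hdV dW hdW) v₀.1
                (UnitaryGroup.finPart (Fp L) L (IsCMField.complexConj L) (n + n) (hermD L e dV hdV dW hdW) h)) ∂(νv v₀.1)) *
      ((∫ p, (conj (unipDeltaChar L e dV hdV dW hdW S
              (UnitaryGroup.archToAdelic (Fp L) L (IsCMField.complexConj L) (n + n) (hermD L e dV hdV dW hdW)
                (p.1 : UnitaryGroup.arch (Fp L) L (IsCMField.complexConj L) (n + n) (hermD L e dV hdV dW hdW))) : ℂ) *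
            ∏ w : {w : T // w ≠ v₀}, conj (unipDeltaChar L e dV hdV dW hdW S
              (locToAdelic L e dV hdV dW hdW w.1.1
                ((p.2 w : ↥(unipDeltaLoc L e dV hdV dW hdW w.1.1)) : UnitaryGroup.localPi L (IsCMField.complexConj L) (n + n) (hermD L e dV hdV dW hdW) w.1.1)) : ℂ)) *
          rT s (UnitaryGroup.archPart (Fp L) L (IsCMField.complexConj L) (n + n) (hermD L e dV hdV dW hdW) (weylDelta L e dV hdV dW hdW) *
                (p.1 : UnitaryGroup.arch (Fp L) L (IsCMField.complexConj L) (n + n) (hermD L e dV hdV dW hdW)) *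
                UnitaryGroup.archPart (Fp L) L (IsCMField.complexConj L) (n + n) (hermD L e dV hdV dW hdW) h,
              fun w : {w : T // w ≠ v₀} => UnitaryGroup.evalPlace (Fp L) L (IsCMField.complexConj L) (n + n) (hermD L e dV hdV dW hdW) w.1.1
                  (UnitaryGroup.finPart (Fp L) L (IsCMField.complexConj L) (n + n) (hermD L e dV hdV dW hdW) (weylDelta L e dV hdV dW hdW)) *
                ((p.2 w : ↥(unipDeltaLoc L e dV hdV dW hdW w.1.1)) : UnitaryGroup.localPi L (IsCMField.complexConj L) (n + n) (hermD L e dV hdV dW hdW) w.1.1) *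
                UnitaryGroup.evalPlace (Fp L) L (IsCMField.complexConj L) (n + n) (hermD L e dV hdV dW hdW) w.1.1
                  (UnitaryGroup.finPart (Fp L) L (IsCMField.complexConj L) (n + n) (hermD L e dV hdV dW hdW) h))
          ∂(νinf.prod (Measure.pi fun w : {w : T // w ≠ v₀} => νv w.1.1))) *
        ∏' v : {v : HeightOneSpectrum (𝓞 (Fp L)) // v ∉ T},
          ∫ y, conj (unipDeltaChar L e dV hdV dW hdW S
              (locToAdelic L e dV hdV dW hdW v.1 (y : UnitaryGroup.localPi L (IsCMField.complexConj L) (n + n) (hermD L e dV hdV dW hdW) v.1)) : ℂ) *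
            LambdaLoc L e dV hdV dW hdW v.1 χ s
              (UnitaryGroup.evalPlace (Fp L) L (IsCMField.complexConj L) (n + n) (hermD L e dV hdV dW hdW) v.1
                  (UnitaryGroup.finPart (Fp L) L (IsCMField.complexConj L) (n + n) (hermD L e dV hdV dW hdW) (weylDelta L e dV hdV dW hdW)) *
                (y : UnitaryGroup.localPi L (IsCMField.complexConj L) (n + n) (hermD L e dV hdV dW hdW) v.1)) ∂(νv v.1)) := by
  rw [(whittakerDelta_eq_mul_tprod_euler L e dV hdV dW hdW T νN νv hνK νinf hmap hχ hfac s S hh hw hS hG).2,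
    integral_prod_pi_eq_mul_of_pureAt (fun v : T => νv v.1) νinf v₀
      (fun a : ↥(unipDeltaArch L e dV hdV dW hdW) => conj (unipDeltaChar L e dV hdV dW hdW S
        (UnitaryGroup.archToAdelic (Fp L) L (IsCMField.complexConj L) (n + n) (hermD L e dV hdV dW hdW)
          (a : UnitaryGroup.arch (Fp L) L (IsCMField.complexConj L) (n + n) (hermD L e dV hdV dW hdW))) : ℂ))
      (fun (v : T) (y : ↥(unipDeltaLoc L e dV hdV dW hdW v.1)) => conj (unipDeltaChar L e dV hdV dW hdW S
        (locToAdelic L e dV hdV dW hdW v.1 (y : UnitaryGroup.localPi L (IsCMField.complexConj L) (n + n) (hermD L e dV hdV dW hdW) v.1)) : ℂ))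
      (fun z => fT s (UnitaryGroup.archPart (Fp L) L (IsCMField.complexConj L) (n + n) (hermD L e dV hdV dW hdW) (weylDelta L e dV hdV dW hdW) *
            (z.1 : UnitaryGroup.arch (Fp L) L (IsCMField.complexConj L) (n + n) (hermD L e dV hdV dW hdW)) *
            UnitaryGroup.archPart (Fp L) L (IsCMField.complexConj L) (n + n) (hermD L e dV hdV dW hdW) h,
          fun v : T => UnitaryGroup.evalPlace (Fp L) L (IsCMField.complexConj L) (n + n) (hermD L e dV hdV dW hdW) v.1
              (UnitaryGroup.finPart (Fp L) L (IsCMField.complexConj L) (n + n) (hermD L e dV hdV dW hdW) (weylDelta L e dV hdV dW hdW)) *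
            ((z.2 v : ↥(unipDeltaLoc L e dV hdV dW hdW v.1)) : UnitaryGroup.localPi L (IsCMField.complexConj L) (n + n) (hermD L e dV hdV dW hdW) v.1) *
            UnitaryGroup.evalPlace (Fp L) L (IsCMField.complexConj L) (n + n) (hermD L e dV hdV dW hdW) v.1
              (UnitaryGroup.finPart (Fp L) L (IsCMField.complexConj L) (n + n) (hermD L e dV hdV dW hdW) h)))
      (fun y : ↥(unipDeltaLoc L e dV hdV dW hdW v₀.1) =>
        bT s (UnitaryGroup.evalPlace (Fp L) L (IsCMField.complexConj L) (n + n) (hermD L e dV hdV dW hdW) v₀.1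
              (UnitaryGroup.finPart (Fp L) L (IsCMField.complexConj L) (n + n) (hermD L e dV hdV dW hdW) (weylDelta L e dV hdV dW hdW)) *
            (y : UnitaryGroup.localPi L (IsCMField.complexConj L) (n + n) (hermD L e dV hdV dW hdW) v₀.1) *
            UnitaryGroup.evalPlace (Fp L) L (IsCMField.complexConj L) (n + n) (hermD L e dV hdV dW hdW) v₀.1
              (UnitaryGroup.finPart (Fp L) L (IsCMField.complexConj L) (n + n) (hermD L e dV hdV dW hdW) h)))
      (fun z => rT s (UnitaryGroup.archPart (Fp L) L (IsCMField.complexConj L) (n + n) (hermD L e dV hdV dW hdW) (weylDelta L e dV hdV dW hdW) *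
            (z.1 : UnitaryGroup.arch (Fp L) L (IsCMField.complexConj L) (n + n) (hermD L e dV hdV dW hdW)) *
            UnitaryGroup.archPart (Fp L) L (IsCMField.complexConj L) (n + n) (hermD L e dV hdV dW hdW) h,
          fun w : {w : T // w ≠ v₀} => UnitaryGroup.evalPlace (Fp L) L (IsCMField.complexConj L) (n + n) (hermD L e dV hdV dW hdW) w.1.1
              (UnitaryGroup.finPart (Fp L) L (IsCMField.complexConj L) (n + n) (hermD L e dV hdV dW hdW) (weylDelta L e dV hdV dW hdW)) *
            ((z.2 w : ↥(unipDeltaLoc L e dV hdV dW hdW w.1.1)) : UnitaryGroup.localPi L (IsCMField.complexConj L) (n + n) (hermD L e dV hdV dW hdW) w.1.1) *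
            UnitaryGroup.evalPlace (Fp L) L (IsCMField.complexConj L) (n + n) (hermD L e dV hdV dW hdW) w.1.1
              (UnitaryGroup.finPart (Fp L) L (IsCMField.complexConj L) (n + n) (hermD L e dV hdV dW hdW) h)))
      (fun a q => hpure s _ _)]
  exact mul_assoc _ _ _

end Euler

end Summit.HodgeConjecture.HodgeConjecture.Cruxes.HLiu418.K2LiuSingularWhittakerPlaceFactorEuler

end
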